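import Mathlib
import HarnessLib

/-!
# Crux `MayerPairing.BranchPairing` (stmt-RiemannHypothesis-1471), line `weinstein-aronszajn-pinning`:
the rank-one Weinstein–Aronszajn equivalence

Route `RiemannHypothesis/MayerPairing`, crux `BranchPairing` (item stmt-RiemannHypothesis-1471), line
`weinstein-aronszajn-pinning`; helper file (supports 1471). Pure Banach-algebra content of the
registered stub `stub_weinsteinAronszajn` (STUB 1 of the checked skeleton), in general form:

* `weinsteinAronszajn_rankOne` : for a bounded operator `T` on a complex Banach space `E`, a
  functional `φ`, a vector `u` and scalars `c, μ` with `μ ∉ spec (T + c·(u ⊗ φ))`,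
  `μ ∈ spec T ↔ 1 + c·φ((μ − T − c·(u ⊗ φ))⁻¹ u) = 0`
  (the first Weinstein–Aronszajn formula / Sherman–Morrison secular equation for a rank-one
  perturbation; T. Kato, *Perturbation theory for linear operators* (1966), IV-§6.1–6.2);
* `isUnit_one_add_smulRight_iff` : `1 + v ⊗ φ` is a unit of `E →L[ℂ] E` iff `1 + φ v ≠ 0`
  (explicit inverse `1 − (1 + φ v)⁻¹ • (v ⊗ φ)`; the `1 − v ⊗ φ` variant is
  `Literature.NumberTheory.Sieve.one_sub_smulRight_inverse`, not imported to keep this file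
  Mathlib-only).

Mechanism: with `S = T + c·K`, `K = u ⊗ φ = φ.smulRight u`, `M = μ − S` a unit and `R = M⁻¹ =
resolvent S μ`, one has `μ − T = M + c·K = M·(1 + R·(c·K))` and `R·(c·K) = (c·R u) ⊗ φ` is rank one.
Mathlib only.
-/

namespace Summit.RiemannHypothesis.RiemannHypothesis.Theorems.MayerPairingPinning

variable {E : Type*} [NormedAddCommGroup E] [NormedSpace ℂ E]

/-- **Rank-one units.** For a continuous functional `φ` and a vector `v` of a complex normed space,
`1 + v ⊗ φ` (i.e. `x ↦ x + φ x • v`) is a unit of the algebra `E →L[ℂ] E` iff `1 + φ v ≠ 0`; the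
inverse is `1 − (1 + φ v)⁻¹ • (v ⊗ φ)` (Sherman–Morrison). [folklore] -/
theorem isUnit_one_add_smulRight_iff (φ : E →L[ℂ] ℂ) (v : E) :
    IsUnit (1 + φ.smulRight v) ↔ 1 + φ v ≠ 0 := by
  constructor
  · intro hU h0
    -- `(1 + P) v = (1 + φ v) • v = 0`, and a unit is injective, so `v = 0`, so `1 = 0`.
    have h1 : (1 + φ.smulRight v) v = 0 := by
      rw [add_apply, one_apply_eq_self, ContinuousLinearMap.smulRight_apply]
      calc v + φ v • v = (1 + φ v) • v := by rw [add_smul, one_smul]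
        _ = 0 := by rw [h0, zero_smul]
    have hv : v = 0 := by
      calc v = ((hU.unit⁻¹ : (E →L[ℂ] E)ˣ) : E →L[ℂ] E) ((hU.unit : E →L[ℂ] E) v) := by
            rw [← mul_apply_eq_comp, Units.inv_mul, one_apply_eq_self]
        _ = 0 := by rw [hU.unit_spec, h1, map_zero]
    rw [hv, map_zero, add_zero] at h0
    exact one_ne_zero h0
  · intro hd
    set d : ℂ := 1 + φ v with hd_def
    set P : E →L[ℂ] E := φ.smulRight v with hP_def
    -- the rank-one operator `P = v ⊗ φ : x ↦ φ x • v` satisfies `P² = φ v • P`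
    -- (cf. `Literature.NumberTheory.Sieve.smulRight_mul_smulRight`, not imported here)
    have hPP : P * P = (φ v) • P := by
      ext x
      simp only [hP_def, mul_apply_eq_comp, ContinuousLinearMap.smulRight_apply, map_smul,
        smul_apply, smul_smul, mul_comm (φ x)]
    have hl : (1 + P) * P = d • P := by
      rw [add_mul, one_mul, hPP, hd_def, add_smul, one_smul]
    have hr : P * (1 + P) = d • P := by
      rw [mul_add, mul_one, hPP, hd_def, add_smul, one_smul]
    have key1 : (1 + P) * (1 - d⁻¹ • P) = 1 := by
      rw [mul_sub, mul_one, mul_smul_comm, hl, smul_smul, inv_mul_cancel₀ hd, one_smul,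
        add_sub_cancel_right]
    have key2 : (1 - d⁻¹ • P) * (1 + P) = 1 := by
      rw [sub_mul, one_mul, smul_mul_assoc, hr, smul_smul, inv_mul_cancel₀ hd, one_smul,
        add_sub_cancel_right]
    exact ⟨⟨1 + P, 1 - d⁻¹ • P, key1, key2⟩, rfl⟩

/-- **Weinstein–Aronszajn, rank one** (registered general form of stub `stub_weinsteinAronszajn` of
stmt-RiemannHypothesis-1471). For a bounded operator `T` on a complex Banach space, a functional `φ`,
a vector `u` and scalars `c, μ` with `μ` in the resolvent set of the rank-one perturbation
`S = T + c·(u ⊗ φ)`: `μ ∈ spec T ↔ 1 + c·φ((μ − S)⁻¹ u) = 0`. Proof: `μ − T = (μ − S)·(1 + (c·R u) ⊗ φ)`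
with `R = (μ − S)⁻¹ = resolvent S μ`, and `isUnit_one_add_smulRight_iff`.
(Kato 1966, IV-§6.1–6.2, first W–A formula.) [folklore] -/
theorem weinsteinAronszajn_rankOne : ∀ (E : Type) [NormedAddCommGroup E] [NormedSpace ℂ E] [CompleteSpace E] (T : E →L[ℂ] E) (φ : E →L[ℂ] ℂ) (u : E) (c μ : ℂ), μ ∉ spectrum ℂ (T + c • φ.smulRight u) → (μ ∈ spectrum ℂ T ↔ 1 + c * φ (resolvent (T + c • φ.smulRight u) μ u) = 0) := by
  intro E _ _ _ T φ u c μ hμ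
  set S : E →L[ℂ] E := T + c • φ.smulRight u with hS_def
  set M : E →L[ℂ] E := algebraMap ℂ (E →L[ℂ] E) μ - S with hM_def
  have hM : IsUnit M := spectrum.notMem_iff.mp hμ
  set R : E →L[ℂ] E := resolvent S μ
  have hMR : M * R = 1 := Ring.mul_inverse_cancel M hM
  -- the factorisation `μ − T = M · (1 + R · (c K))`
  have hfac : algebraMap ℂ (E →L[ℂ] E) μ - T = M * (1 + R * (c • φ.smulRight u)) := by
    rw [mul_add, mul_one, ← mul_assoc, hMR, one_mul, hM_def, hS_def]
    abel
  -- `R · (c K)` is the rank-one operator `(c • R u) ⊗ φ`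
  have hrk : R * (c • φ.smulRight u) = φ.smulRight (c • R u) := by
    ext x
    simp only [mul_apply_eq_comp, smul_apply, ContinuousLinearMap.smulRight_apply, map_smul,
      smul_smul, mul_comm c]
  obtain ⟨m, hm⟩ := hM
  rw [spectrum.mem_iff, hfac, hrk, ← hm, Units.isUnit_units_mul, isUnit_one_add_smulRight_iff,
    not_not, map_smul, smul_eq_mul]

end Summit.RiemannHypothesis.RiemannHypothesis.Theorems.MayerPairingPinning
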